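import Literature.Probability.Percolation.ArmSeparationOuter
import Literature.Probability.Percolation.ArmSeparationSpoke
import HarnessLib

/-!
# Beacons and spokes for fenced OUTER tips

Topic: Probability / Percolation; family `crit-perc`. A brick of the discharge of
`Literature.Probability.Percolation.Nolin2008_twoArm_separation` (Nolin 2008, Thm. 11
[arXiv 0711.4948: Thm. 10], `j = 2`, `σ = BW`; `ArmSeparation.lean`), landing step of the EXTERNAL
extremities (Nolin 2008, Prop. 12 (iii)–(i) [arXiv Prop. 11] on the external boundary: "there
exists some landing sequence `I_{η'}` … and then we can reach `I_{η'₀}` on the next scale", via RSW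
corridors glued by the generalised FKG inequality). This is the outward twin of
`ArmSeparationBeacon.lean` and `ArmSeparationSpoke.lean`: a fenced outer tip (`TrapFencedArm`,
`ArmSeparationOuter.lean`; free space `[2M+k, 2M+2k] × [t+k, t+2k]` OUTSIDE `Λ_{2M}`, crossed
vertically) read in an axis-compatible frame `frameIso i` (`ArmSeparationInnerFrames.lean`) is
caught by a **beacon** — the open frame `triFrameAt c' (k/2)` about `c' = (2M + 2k - 1, T₀ + 2k + w)`
of the tip's frame, for tip rows `t ∈ [T₀, T₀ + w)` — and hooked to the first corridor, the
**spoke**: the thin horizontal tube `[c'₀ - k/4, c'₀ + L] × [c'₁ - ε, c'₁ + ε]` of the tip's frame,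
leaving the beacon outward.

* `obcnCentre M k T₀ w`, `otipBox M t k` (a box outside `Λ_{2M}` above the tip row containing the
  free space, the exterior part of the fence zone and the beacon);
* `out_beacon_catch` — for a fenced outer arm `Fo` in the frame `i` with tip row in the window, a
  beacon realised by `frameConfig i ω`, and a tight open path of `ω` from `|p - c| ≤ k/2` to
  `|q - c| ≥ 2k` (`c = frameIso i c'`), the start `p` is joined to the far (inner) end
  `frameIso i Fo.a` of the arm (a site of norm `n`) inside `S ∪ frameIso i ({n ≤ |v| ≤ 2M} ∪ otipBox)`;
* `ospokeTube`, `ospokeEvent i …` (increasing, local, `P`-invariant);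
* `out_arm_to_entry` — **the hook**: beacon + spoke + a crossing `(xE, yE)` of a tube `E` of the
  original frame meeting the spoke (`SpokeMeets i`, `ArmSeparationSpoke.lean`) ⟹ `frameIso i Fo.a`
  is joined to `xE` by an open path inside `frameIso i (spoke ∪ {n ≤ |v| ≤ 2M} ∪ otipBox) ∪ E`.

## References

* P. Nolin, *Near-critical percolation in two dimensions*, Electron. J. Probab. 13 (2008), §4.2
  Def. 6, §4.3 Prop. 12, §4.4 (proof of Thm. 11, external extremities) [arXiv 0711.4948: Def. 6,
  Prop. 11, Thm. 10]. [Nolin2008]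
* H. Kesten, *Scaling relations for 2D-percolation*, Comm. Math. Phys. 109 (1987), Lemma 2 (fences). [Kesten1987]

Tree: `TrapFencedArm`, `trapO_coord`, `trapD_subset_triAnnSet`, `trapFrameZone` (`ArmSeparationOuter.lean`,
`ArmSeparationTrapezoid.lean`, `ArmSeparationReroute.lean`, `ArmSeparationFrame.lean`); `frameIso`,
`frameConfig`, `pathIn_frameConfig`, `pathIn_of_frameConfig`, `frameIso_sub`, `frameIso_symm_sub`,
`triNorm_frameIso`, `triNorm_frameIso_symm`, `frameIso_apply_formula` (`ArmSeparationInnerFrames.lean`);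
`FrameData`, `nonempty_frameData`, `exists_mem_K`, `pathIn_K` (`ArmSeparationFrame.lean`,
`ArmSeparationBeacon.lean`); `Tube`, `SpokeMeets`, `isUpperSet_preimage_frameConfig`,
`determinedBy_preimage_frameConfig` (`ArmSeparationTubes.lean`, `ArmSeparationSpoke.lean`);
`exists_mem_of_cross`; `PathIn.exists_support`.
-/

noncomputable section

open Set MeasureTheory

namespace Literature.Probability.Percolation

open LatticeModels Tube

/-! ### The beacon and the tip box -/

/-- **The centre of the beacon** of an outer tip in the window `[T₀, T₀ + w)` at scale `k` (tip's
frame): `c' = (2M + 2k - 1, T₀ + 2k + w)`; the beacon is the open frame `triFrameAt c' (k/2)`, whose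
bottom strip `[c'₀ - k, c'₀ + k] × [c'₁ - k, c'₁ - k/2]` crosses the outer free space
`[2M+k, 2M+2k] × [t+k, t+2k]` of every tip row `t` of the window horizontally. [cite: Nolin2008, §4.2 Def. 6 (free spaces) (arXiv 0711.4948)] -/
def obcnCentre (M k : ℕ) (T₀ : ℤ) (w : ℕ) : Site 2 := ![2 * (M : ℤ) + 2 * k - 1, T₀ + 2 * k + w]

/-- **The outer tip box**: the sites `[2M + 1, 2M + 5k] × (t, t + 4k]` of the tip's frame — outside
`Λ_{2M}`, above the tip row, containing the free space, the exterior part of the fence zone and the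
beacon. [cite: Nolin2008, §4.2 Def. 6 (free spaces) (arXiv 0711.4948)] -/
def otipBox (M : ℕ) (t : ℤ) (k : ℕ) : Set (Site 2) :=
  {v | 2 * (M : ℤ) + 1 ≤ v 0 ∧ v 0 ≤ 2 * (M : ℤ) + 5 * k ∧ t < v 1 ∧ v 1 ≤ t + 4 * k}

/-- Membership in the outer tip box. [folklore] -/
@[simp] theorem mem_otipBox {M k : ℕ} {t : ℤ} {v : Site 2} :
    v ∈ otipBox M t k ↔ 2 * (M : ℤ) + 1 ≤ v 0 ∧ v 0 ≤ 2 * (M : ℤ) + 5 * k ∧ t < v 1 ∧ v 1 ≤ t + 4 * k := Iff.rfl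

/-- **The outer tip box lies just outside `Λ_{2M}`**: `2M < |v| ≤ 2M + 5k` for its sites, when
the tip row satisfies `-2M ≤ t` and `t + 4k ≤ 0`. [folklore] -/
theorem norm_mem_of_mem_otipBox {M k : ℕ} {t : ℤ} (h1 : -(2 * (M : ℤ)) ≤ t) (h2 : t + 4 * k ≤ 0) {v : Site 2} (hv : v ∈ otipBox M t k) :
    2 * (M : ℤ) < triNorm v ∧ triNorm v ≤ 2 * (M : ℤ) + 5 * k := by
  rw [mem_otipBox] at hv
  exact ⟨lt_triNorm_iff_lin.2 (Or.inl (by omega)), triNorm_le_iff_lin.2 (by omega)⟩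

/-! ### The catch -/

/-- **Catching a fenced outer tip through its beacon.** Let `Fo` be a fenced outer arm of
`frameConfig i ω` (`i < 6`; `n ≤ M`), with scale `k = k₀ · 32^j ≥ 4`, tip row `t ∈ [T₀, T₀ + w)`
(`4w ≤ k`) and `t + 4k + 2 ≤ 0`, and suppose `frameConfig i ω` realises the beacon
`triFrameAt c' (k/2)`, `c' = obcnCentre M k T₀ w`. Let `S ⊆ ω` carry an open path from `p` to `q`,
star-shaped from `p`, with `|p - c|_𝕋 ≤ k/2` and `|q - c|_𝕋 ≥ 2k`, `c = frameIso i c'`. Then `p` is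
joined to the inner end `frameIso i Fo.a` of the arm by an open path of `ω` inside
`S ∪ frameIso i ({n ≤ |v| ≤ 2M} ∪ otipBox M t k)`: in the tip's frame the path meets the beacon
(`FrameData.exists_mem_K`), the beacon's bottom strip meets the free space crossing through
`Fo.m` (`exists_mem_of_cross`), and `Fo.m` is joined to `Fo.a` (`Fo.path`). [cite: Nolin2008, §4.3 Prop. 12 (proof) and §4.4 (arXiv 0711.4948: Prop. 11, Thm. 10)] -/
theorem out_beacon_catch {M n k₀ K : ℕ} (hnM : n ≤ M) {i : ℕ} (hi : i < 6) {ω : SiteConfig (Site 2)}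
    (Fo : TrapFencedArm M n k₀ K (frameConfig i ω)) {T₀ : ℤ} {w : ℕ} (hwk : 4 * w ≤ Fo.k) (hk : 4 ≤ Fo.k)
    (hwin : T₀ ≤ Fo.z 1 ∧ Fo.z 1 < T₀ + w) (ht4 : Fo.z 1 + 4 * Fo.k + 2 ≤ 0)
    (hB : frameConfig i ω ∈ triFrameAt (obcnCentre M Fo.k T₀ w) (Fo.k / 2))
    {S : Set (Site 2)} (hS : S ⊆ ω) {p q : Site 2} (hP : PathIn triGraph S p q) (hstar : ∀ v ∈ S, PathIn triGraph S p v)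
    (hp : triNorm (p - frameIso i (obcnCentre M Fo.k T₀ w)) ≤ (Fo.k / 2 : ℕ))
    (hq : 2 * (Fo.k : ℤ) ≤ triNorm (q - frameIso i (obcnCentre M Fo.k T₀ w))) :
    PathIn triGraph ((S ∪ frameIso i '' (triAnnSet n (2 * M) ∪ otipBox M (Fo.z 1) Fo.k)) ∩ ω) p (frameIso i Fo.a) := by
  have hk1 : 1 ≤ Fo.k / 2 := by omega
  have hkk : 2 * ((Fo.k / 2 : ℕ) : ℤ) ≤ Fo.k ∧ (Fo.k : ℤ) ≤ 2 * ((Fo.k / 2 : ℕ) : ℤ) + 1 := by omega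
  have hwk' : 4 * (w : ℤ) ≤ Fo.k := by exact_mod_cast hwk
  have hk4 : (4 : ℤ) ≤ Fo.k := by exact_mod_cast hk
  obtain ⟨c', hc'⟩ : ∃ c' : Site 2, c' = obcnCentre M Fo.k T₀ w := ⟨_, rfl⟩
  rw [← hc'] at hB hp hq
  have hc'0 : c' 0 = 2 * (M : ℤ) + 2 * Fo.k - 1 := by rw [hc']; exact site_mk_apply_zero _ _
  have hc'1 : c' 1 = T₀ + 2 * Fo.k + w := by rw [hc']; exact site_mk_apply_one _ _
  obtain ⟨hz0, hz1, hz2⟩ := trapO_coord Fo.z_mem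
  -- (1) the fence through `m`, with a support star-shaped from `m`
  obtain ⟨bb, tt, hbb, htt, P1, P2⟩ := Fo.tipOK.1
  obtain ⟨Sa, hSa, Pa, Ta⟩ := P1.symm.exists_support
  obtain ⟨Sb, hSb, Pb, Tb⟩ := P2.exists_support
  have hkj : ((trapScale k₀ Fo.j : ℕ) : ℤ) = Fo.k := rfl
  have Tf : ∀ v ∈ Sa ∪ Sb, PathIn triGraph (Sa ∪ Sb) Fo.m v := by
    rintro v (hv | hv)
    · exact (Ta v hv).mono subset_union_left
    · exact (Tb v hv).mono subset_union_right
  have Pf : PathIn triGraph (Sa ∪ Sb) bb tt := (Tf bb (Or.inl Pa.right_mem)).symm.trans (Tf tt (Or.inr Pb.right_mem))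
  have hSf : ∀ v ∈ Sa ∪ Sb, (2 * (M : ℤ) + Fo.k ≤ v 0 ∧ v 0 ≤ 2 * (M : ℤ) + 2 * Fo.k ∧ (Fo.z 1) + Fo.k ≤ v 1 ∧ v 1 ≤ (Fo.z 1) + 2 * Fo.k) ∧
      v ∈ (frameConfig i ω) := by
    rintro v hv
    have h := (Set.union_subset hSa hSb) hv
    obtain ⟨h1, h2⟩ := h
    rw [mem_triStrip, hkj, hz0] at h1
    exact ⟨by omega, h2⟩
  -- (2) the beacon; its bottom strip meets the fence
  obtain ⟨F⟩ := nonempty_frameData hB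
  obtain ⟨v₁, hv₁S, hv₁f⟩ := exists_mem_of_cross (L := 2 * (M : ℤ) + Fo.k) (R := 2 * (M : ℤ) + 2 * Fo.k) (B := (Fo.z 1) + Fo.k)
    (T := (Fo.z 1) + 2 * Fo.k)
    (by omega) (by omega) F.pathS (by rw [F.xS0, hc'0]; omega) (by rw [F.yS0, hc'0]; omega)
    (fun v hv _ _ => by have := F.boundsS hv; rw [hc'1] at this; omega)
    Pf (by rw [hbb, hkj]) (by rw [htt, hkj]) (fun v hv _ _ => ⟨(hSf v hv).1.1, (hSf v hv).1.2.1⟩)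
  have hv₁K : v₁ ∈ F.K := Or.inl (Or.inl (Or.inr hv₁S))
  have toMM : ∀ x ∈ F.K, PathIn triGraph (F.K ∪ (Sa ∪ Sb)) x Fo.m := fun x hx =>
    ((F.pathIn_K hk1 hx hv₁K).mono subset_union_left).trans ((Tf v₁ hv₁f).symm.mono subset_union_right)
  -- (3) the original path, read in the tip's frame, pierces the beacon
  set S' : Set (Site 2) := (frameIso i).symm '' S with hS'
  have hP' : PathIn triGraph (S ∩ {v | v ∈ ω ↔ true}) p q := hP.mono fun v hv => ⟨hv, by simpa using hS hv⟩
  have P' := pathIn_frameConfig i hP'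
  have star' : ∀ y ∈ S' ∩ {v | v ∈ (frameConfig i ω) ↔ true}, PathIn triGraph (S' ∩ {v | v ∈ (frameConfig i ω) ↔ true}) ((frameIso i).symm p) y := by
    rintro y ⟨⟨v, hv, rfl⟩, -⟩
    exact pathIn_frameConfig i ((hstar v hv).mono fun u hu => ⟨hu, by simpa using hS hu⟩)
  have hsub : ∀ a : Site 2, (frameIso i).symm a - c' = (frameIso i).symm (a - frameIso i c') := fun a => by
    rw [frameIso_symm_sub i hi, RelIso.symm_apply_apply]
  have hp' : triNorm ((frameIso i).symm p - c') ≤ ((Fo.k / 2 : ℕ) : ℤ) := by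
    rw [hsub, triNorm_frameIso_symm i hi]; exact hp
  have hq' : 2 * (Fo.k : ℤ) ≤ triNorm ((frameIso i).symm q - c') := by
    rw [hsub, triNorm_frameIso_symm i hi]; exact hq
  have hpl := triNorm_le_iff_lin.1 hp'
  have hql := le_triNorm_iff_lin.1 hq'
  simp only [Pi.sub_apply] at hpl hql
  obtain ⟨x, hxS, hxK⟩ := F.exists_mem_K hk1 (s := (frameIso i).symm p) (t := (frameIso i).symm q)
    (by omega) (by omega) P'
  -- (4) assemble in the tip's frame
  have hnM' : (n : ℤ) ≤ M := by exact_mod_cast hnM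
  set R : Set (Site 2) := (S' ∪ (triAnnSet n (2 * M) ∪ otipBox M (Fo.z 1) Fo.k)) ∩ {v | v ∈ (frameConfig i ω) ↔ true} with hR
  have hKR : F.K ∪ (Sa ∪ Sb) ⊆ R := by
    rintro v (hv | hv)
    · have hb := F.boundsK hv
      rw [hc'0, hc'1] at hb
      refine ⟨Or.inr (Or.inr ⟨by omega, by omega, by omega, by omega⟩), by simpa using F.K_subset hv⟩
    · obtain ⟨hb, hvχ⟩ := hSf v hv
      exact ⟨Or.inr (Or.inr ⟨by omega, by omega, by omega, by omega⟩), by simpa using hvχ⟩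
  have hZR : (triAnnSet n (2 * M) ∪ trapFrameZone M Fo.z Fo.k) ∩ (frameConfig i ω) ⊆ R := by
    rintro v ⟨hv | hv, hvχ⟩
    · exact ⟨Or.inr (Or.inl hv), by simpa using hvχ⟩
    · rw [mem_trapFrameZone] at hv
      obtain ⟨h1, h2, h3, h4, h5⟩ := hv
      rcases h1 with h1 | ⟨h1, h1'⟩
      · exact ⟨Or.inr (Or.inl (trapD_subset_triAnnSet hnM (Finset.mem_coe.2 h1))), by simpa using hvχ⟩
      · have hn := lt_triNorm_iff_lin.1 h1
        refine ⟨Or.inr (Or.inr ⟨by omega, by omega, h1', by omega⟩), by simpa using hvχ⟩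
  have Q1 : PathIn triGraph R ((frameIso i).symm p) x := (star' x hxS).mono fun v hv => ⟨Or.inl hv.1, hv.2⟩
  have Q2 : PathIn triGraph R x Fo.m := (toMM x hxK).mono hKR
  have Q3 : PathIn triGraph R Fo.m Fo.a := Fo.path.symm.mono hZR
  -- (5) back to the original frame
  have Q := pathIn_of_frameConfig i ((Q1.trans Q2).trans Q3)
  rw [RelIso.apply_symm_apply] at Q
  refine Q.mono ?_
  rintro v ⟨⟨u, hu, rfl⟩, hvω⟩
  refine ⟨?_, by simpa using hvω⟩
  rcases hu with ⟨v, hv, rfl⟩ | hu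
  · left; rw [RelIso.apply_symm_apply]; exact hv
  · exact Or.inr ⟨u, hu, rfl⟩

/-! ### The spoke -/

/-- **The outer spoke** of a tip at scale `k` in the window `[T₀, T₀ + w)` (tip's frame): the tube
`[c'₀ - k/4, c'₀ + L] × [c'₁ - ε, c'₁ + ε]` through the beacon centre `c' = obcnCentre M k T₀ w`,
crossed horizontally (from inside the beacon outward). [cite: Nolin2008, §4.3 Prop. 12 (proof) (arXiv 0711.4948: Prop. 11)] -/
def ospokeTube (M k : ℕ) (T₀ : ℤ) (w L ε : ℕ) : Tube :=
  ⟨(obcnCentre M k T₀ w) 0 - (k / 4 : ℕ), (obcnCentre M k T₀ w) 1 - ε, L + k / 4, 2 * ε, true⟩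

/-- **The outer spoke is crossed** (an event of the original configuration, read in the frame `i`). [cite: Nolin2008, §4.3 Prop. 12 (proof) (arXiv 0711.4948: Prop. 11)] -/
def ospokeEvent (i M k : ℕ) (T₀ : ℤ) (w L ε : ℕ) : Set (SiteConfig (Site 2)) :=
  {χ | frameConfig i χ ∈ (ospokeTube M k T₀ w L ε).event}

/-- The outer spoke event is increasing. [folklore] -/
theorem isUpperSet_ospokeEvent (i M k : ℕ) (T₀ : ℤ) (w L ε : ℕ) : IsUpperSet (ospokeEvent i M k T₀ w L ε) :=
  isUpperSet_preimage_frameConfig i (ospokeTube M k T₀ w L ε).isUpperSet_event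

/-- The outer spoke event is determined by the image of the spoke's box. [folklore] -/
theorem determinedBy_ospokeEvent (i M k : ℕ) (T₀ : ℤ) (w L ε : ℕ) :
    DeterminedBy (ospokeEvent i M k T₀ w L ε) (frameIso i '' (ospokeTube M k T₀ w L ε).box) := by
  have h := determinedBy_preimage_frameConfig i (ospokeTube M k T₀ w L ε).determinedBy_event
  rwa [coe_sites] at h

/-- The probability of the outer spoke event is that of crossing the spoke tube. [folklore] -/
theorem real_ospokeEvent (i M k : ℕ) (T₀ : ℤ) (w L ε : ℕ) :
    (triSitePercolation half).real (ospokeEvent i M k T₀ w L ε) = (triSitePercolation half).real (ospokeTube M k T₀ w L ε).event :=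
  real_preimage_frameConfig half i _

/-- **Where the outer spoke is**: a site of the spoke's box has `2M + 2k - 1 - k/4 ≤ u₀ ≤ 2M + 2k - 1 + L`
and `T₀ + 2k + w - ε ≤ u₁ ≤ T₀ + 2k + w + ε`. [folklore] -/
theorem bounds_of_mem_ospokeBox {M k : ℕ} {T₀ : ℤ} {w L ε : ℕ} {u : Site 2} (hu : u ∈ (ospokeTube M k T₀ w L ε).box) :
    2 * (M : ℤ) + 2 * k - 1 - (k / 4 : ℕ) ≤ u 0 ∧ u 0 ≤ 2 * (M : ℤ) + 2 * k - 1 + L ∧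
      T₀ + 2 * k + w - ε ≤ u 1 ∧ u 1 ≤ T₀ + 2 * k + w + ε := by
  rw [Tube.mem_box] at hu
  simp only [ospokeTube, obcnCentre, site_mk_apply_zero, site_mk_apply_one] at hu
  push_cast at hu
  omega

/-- **The outer spoke lies in the annulus `(2M, 4M]`**: norms in `(2M, 2M + 2k + L + …]`, precisely
`2M < |u| ≤ 2M + 2k + L` for a site `u` of the spoke's box, when the tip row window satisfies
`-2M + 4k ≤ T₀`, `T₀ + w + 3k ≤ 0`... (`4 ≤ k`, `4ε ≤ k`). [folklore] -/
theorem norm_mem_of_mem_ospokeBox {M k : ℕ} {T₀ : ℤ} {w L ε : ℕ} (hk : 4 ≤ k) (hε : 4 * ε ≤ k)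
    (hT1 : -(2 * (M : ℤ)) ≤ T₀) (hT2 : T₀ + w + 2 * k + ε ≤ 0) {u : Site 2} (hu : u ∈ (ospokeTube M k T₀ w L ε).box) :
    2 * (M : ℤ) < triNorm u ∧ triNorm u ≤ 2 * (M : ℤ) + 2 * k + L := by
  obtain ⟨h1, h2, h3, h4⟩ := bounds_of_mem_ospokeBox hu
  have hk4 : 4 * ((k / 4 : ℕ) : ℤ) ≤ k := by omega
  have hε' : 4 * (ε : ℤ) ≤ k := by exact_mod_cast hε
  exact ⟨lt_triNorm_iff_lin.2 (Or.inl (by omega)), triNorm_le_iff_lin.2 (by omega)⟩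

/-! ### The hook -/

/-- **From the fenced outer arm to the entry tube.** Let `Fo` be a fenced outer arm of
`frameConfig i χ` (`i < 6`, `n ≤ M`), with scale `k ≥ 4`, tip row in the window `[T₀, T₀ + w)`
(`4w ≤ k`, `t + 4k + 2 ≤ 0`); suppose the beacon `triFrameAt c' (k/2)` and the spoke (`4ε ≤ k`,
`2k ≤ L`) are realised, and let `(xE, yE)` be a crossing in `χ` of a tube `E` of the original frame
meeting the spoke (`SpokeMeets i`). Then the inner end `frameIso i Fo.a` of the arm is joined to
`xE` by an open path of `χ` inside `frameIso i (spoke ∪ {n ≤ |v| ≤ 2M} ∪ otipBox) ∪ E`: the spoke's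
crossing starts in `|v - c'| ≤ k/2` and ends in `|v - c'| ≥ 2k`, so it is hooked to the arm by
`out_beacon_catch`, and read in the original frame it meets the crossing of `E`
(`exists_mem_of_cross`, frame by frame as in `arm_to_entry`). [cite: Nolin2008, §4.3 Prop. 12 (proof) and §4.4 (arXiv 0711.4948: Prop. 11, Thm. 10)] -/
theorem out_arm_to_entry {M n k₀ K : ℕ} (hnM : n ≤ M) {i : ℕ} (hi : i < 6) {χ : SiteConfig (Site 2)}
    (Fo : TrapFencedArm M n k₀ K (frameConfig i χ)) {T₀ : ℤ} {w : ℕ} (hwk : 4 * w ≤ Fo.k) (hk : 4 ≤ Fo.k)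
    (hwin : T₀ ≤ Fo.z 1 ∧ Fo.z 1 < T₀ + w) (ht4 : Fo.z 1 + 4 * Fo.k + 2 ≤ 0)
    (hB : frameConfig i χ ∈ triFrameAt (obcnCentre M Fo.k T₀ w) (Fo.k / 2))
    {L ε : ℕ} (hε : 4 * ε ≤ Fo.k) (hL : 2 * Fo.k ≤ L) (hSp : χ ∈ ospokeEvent i M Fo.k T₀ w L ε)
    {E : Tube} {xE yE : Site 2} (hE : E.IsCrossing χ xE yE) (hJ : SpokeMeets i (ospokeTube M Fo.k T₀ w L ε) E) :
    PathIn triGraph ((frameIso i '' ((ospokeTube M Fo.k T₀ w L ε).box ∪ (triAnnSet n (2 * M) ∪ otipBox M (Fo.z 1) Fo.k)) ∪ E.box) ∩ χ)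
      (frameIso i Fo.a) xE := by
  have hk4 : 4 * ((Fo.k / 4 : ℕ) : ℤ) ≤ Fo.k ∧ (Fo.k : ℤ) ≤ 4 * ((Fo.k / 4 : ℕ) : ℤ) + 3 := by omega
  have hk2 : 2 * ((Fo.k / 2 : ℕ) : ℤ) ≤ Fo.k ∧ (Fo.k : ℤ) ≤ 2 * ((Fo.k / 2 : ℕ) : ℤ) + 1 := by omega
  have hk42 : ((Fo.k / 4 : ℕ) : ℤ) + (Fo.k / 4 : ℕ) ≤ (Fo.k / 2 : ℕ) := by omega
  have hε' : 4 * (ε : ℤ) ≤ Fo.k := by exact_mod_cast hε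
  have hεq : (ε : ℤ) ≤ (Fo.k / 4 : ℕ) := by omega
  have hL' : 2 * (Fo.k : ℤ) ≤ L := by exact_mod_cast hL
  obtain ⟨Sp, hSp'⟩ : ∃ Sp : Tube, Sp = ospokeTube M Fo.k T₀ w L ε := ⟨_, rfl⟩
  obtain ⟨c', hc'⟩ : ∃ c' : Site 2, c' = obcnCentre M Fo.k T₀ w := ⟨_, rfl⟩
  have hSa : Sp.a = c' 0 - (Fo.k / 4 : ℕ) := by rw [hSp', hc']; rfl
  have hSb : Sp.b = c' 1 - ε := by rw [hSp', hc']; rfl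
  have hSw : Sp.w = L + Fo.k / 4 := by rw [hSp']; rfl
  have hSh : Sp.h = 2 * ε := by rw [hSp']; rfl
  have hSp2 : frameConfig i χ ∈ Sp.event := by rw [hSp']; exact hSp
  rw [← hSp'] at hJ ⊢
  rw [← hc'] at hB
  -- (1) the crossing of the spoke in the tip's frame, read in the original frame, with a tight support
  obtain ⟨x', y', hs, P'⟩ := Sp.exists_isCrossing hSp2
  have hs' : x' 0 = Sp.a ∧ y' 0 = Sp.a + Sp.w := by rw [hSp'] at hs ⊢; exact hs
  have hx'b : x' ∈ Sp.box := P'.left_mem.1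
  have hy'b : y' ∈ Sp.box := P'.right_mem.1
  rw [Tube.mem_box] at hx'b hy'b
  have Pphys : PathIn triGraph ((frameIso i '' Sp.box) ∩ {v | v ∈ χ ↔ true}) (frameIso i x') (frameIso i y') :=
    pathIn_of_frameConfig i (P'.mono fun v hv => ⟨hv.1, by simpa using hv.2⟩)
  obtain ⟨S, hS, PS, TS⟩ := Pphys.exists_support
  have hSχ : S ⊆ χ := fun v hv => by simpa using (hS hv).2
  have star : ∀ u ∈ S, ∀ v ∈ S, PathIn triGraph S u v := fun u hu v hv => (TS u hu).symm.trans (TS v hv)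
  -- (2) the beacon catches the start `frameIso i x'` of the spoke
  have hp : triNorm (frameIso i x' - frameIso i c') ≤ (Fo.k / 2 : ℕ) := by
    rw [← frameIso_sub i hi, triNorm_frameIso i hi]
    refine triNorm_le_iff_lin.2 ?_
    simp only [Pi.sub_apply]
    omega
  have hq : 2 * (Fo.k : ℤ) ≤ triNorm (frameIso i y' - frameIso i c') := by
    rw [← frameIso_sub i hi, triNorm_frameIso i hi]
    refine le_triNorm_iff_lin.2 (Or.inl ?_)
    simp only [Pi.sub_apply]
    omega
  rw [hc'] at hB hp hq
  have hcatch := out_beacon_catch hnM hi Fo hwk hk hwin ht4 hB hSχ PS (TS) hp hq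
  -- (3) the spoke meets the crossing of `E`
  obtain ⟨SE, hSE, PE, TE⟩ := hE.2.exists_support
  have physS : ∀ v ∈ S, ∃ u ∈ Sp.box, frameIso i u = v := fun v hv => by
    obtain ⟨⟨u, hu, huv⟩, -⟩ := hS hv; exact ⟨u, hu, huv⟩
  have hEbox : ∀ z ∈ SE, E.a ≤ z 0 ∧ z 0 ≤ E.a + E.w ∧ E.b ≤ z 1 ∧ z 1 ≤ E.b + E.h := fun z hz =>
    (Tube.mem_box E).1 (hSE hz).1
  have hE1 := hE.1
  have meet : ∃ z, z ∈ S ∧ z ∈ SE := by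
    interval_cases i
    · -- frame 0: the spoke is horizontal, `E` vertical across it
      obtain ⟨hEh, h1, h2, h3, h4⟩ := hJ
      rw [hEh] at hE1
      obtain ⟨hxE, hyE⟩ : xE 1 = E.b ∧ yE 1 = E.b + E.h := hE1
      obtain ⟨fx0, -⟩ := frameIso_apply_formula x'
      obtain ⟨fy0, -⟩ := frameIso_apply_formula y'
      refine exists_mem_of_cross (L := E.a) (R := E.a + E.w) (B := E.b) (T := E.b + E.h) (by omega) (by omega)
        PS (by rw [fx0]; omega) (by rw [fy0]; omega) (fun z hz _ _ => ?_) PE (by omega) (by omega)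
        (fun z hz _ _ => ⟨(hEbox z hz).1, (hEbox z hz).2.1⟩)
      obtain ⟨u, hu, rfl⟩ := physS z hz
      obtain ⟨g0, g1, -⟩ := frameIso_apply_formula u
      rw [Tube.mem_box] at hu; rw [g0, g1] at *; constructor <;> omega
    · -- frame 1 (`ρ`): the spoke is the slanted strip `x₀ ∈ [-(b+h), -b]`, `x₀ + x₁ ∈ [a, a+w]`; `E` horizontal
      obtain ⟨hEh, h1, h2, h3, h4⟩ := hJ
      rw [hEh] at hE1
      obtain ⟨hxE, hyE⟩ : xE 0 = E.a ∧ yE 0 = E.a + E.w := hE1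
      obtain ⟨-, -, fx0, fx1, -⟩ := frameIso_apply_formula x'
      obtain ⟨-, -, fy0, fy1, -⟩ := frameIso_apply_formula y'
      obtain ⟨z, hzE, hzS⟩ := exists_mem_of_cross (L := -(Sp.b + Sp.h)) (R := -Sp.b) (B := E.b) (T := E.b + E.h)
        (by omega) (by omega) PE (by omega) (by omega) (fun z hz _ _ => ⟨(hEbox z hz).2.2.1, (hEbox z hz).2.2.2⟩)
        PS (by rw [fx1]; omega) (by rw [fy1]; omega) (fun z hz _ _ => by
          obtain ⟨u, hu, rfl⟩ := physS z hz
          obtain ⟨-, -, g0, g1, -⟩ := frameIso_apply_formula u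
          rw [Tube.mem_box] at hu; rw [g0]; constructor <;> omega)
      exact ⟨z, hzS, hzE⟩
    · -- frame 2 (`σ`): the spoke is the vertical tube `[b, b+h] × [a, a+w]`; `E` horizontal
      obtain ⟨hEh, h1, h2, h3, h4⟩ := hJ
      rw [hEh] at hE1
      obtain ⟨hxE, hyE⟩ : xE 0 = E.a ∧ yE 0 = E.a + E.w := hE1
      obtain ⟨-, -, -, -, fx0, fx1, -⟩ := frameIso_apply_formula x'
      obtain ⟨-, -, -, -, fy0, fy1, -⟩ := frameIso_apply_formula y'
      obtain ⟨z, hzE, hzS⟩ := exists_mem_of_cross (L := Sp.b) (R := Sp.b + Sp.h) (B := E.b) (T := E.b + E.h)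
        (by omega) (by omega) PE (by omega) (by omega) (fun z hz _ _ => ⟨(hEbox z hz).2.2.1, (hEbox z hz).2.2.2⟩)
        PS (by rw [fx1]; omega) (by rw [fy1]; omega) (fun z hz _ _ => by
          obtain ⟨u, hu, rfl⟩ := physS z hz
          obtain ⟨-, -, -, -, g0, g1, -⟩ := frameIso_apply_formula u
          rw [Tube.mem_box] at hu; rw [g0]; constructor <;> omega)
      exact ⟨z, hzS, hzE⟩
    · -- frame 3 (`-id`): the spoke is the reflected horizontal tube; `E` vertical
      obtain ⟨hEh, h1, h2, h3, h4⟩ := hJ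
      rw [hEh] at hE1
      obtain ⟨hxE, hyE⟩ : xE 1 = E.b ∧ yE 1 = E.b + E.h := hE1
      obtain ⟨-, -, -, -, -, -, fx0, fx1, -⟩ := frameIso_apply_formula x'
      obtain ⟨-, -, -, -, -, -, fy0, fy1, -⟩ := frameIso_apply_formula y'
      refine exists_mem_of_cross (L := E.a) (R := E.a + E.w) (B := E.b) (T := E.b + E.h) (by omega) (by omega)
        PS.symm (by rw [fy0]; omega) (by rw [fx0]; omega) (fun z hz _ _ => ?_) PE (by omega) (by omega)
        (fun z hz _ _ => ⟨(hEbox z hz).1, (hEbox z hz).2.1⟩)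
      obtain ⟨u, hu, rfl⟩ := physS z hz
      obtain ⟨-, -, -, -, -, -, g0, g1, -⟩ := frameIso_apply_formula u
      rw [Tube.mem_box] at hu; rw [g1]; constructor <;> omega
    · -- frame 4 (`ρ⁴ = -ρ`): the spoke is the slanted strip `x₀ ∈ [b, b+h]`, `x₀ + x₁ ∈ [-(a+w), -a]`; `E` horizontal
      obtain ⟨hEh, h1, h2, h3, h4⟩ := hJ
      rw [hEh] at hE1
      obtain ⟨hxE, hyE⟩ : xE 0 = E.a ∧ yE 0 = E.a + E.w := hE1
      obtain ⟨-, -, -, -, -, -, -, -, fx0, fx1, -⟩ := frameIso_apply_formula x'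
      obtain ⟨-, -, -, -, -, -, -, -, fy0, fy1, -⟩ := frameIso_apply_formula y'
      obtain ⟨z, hzE, hzS⟩ := exists_mem_of_cross (L := Sp.b) (R := Sp.b + Sp.h) (B := E.b) (T := E.b + E.h)
        (by omega) (by omega) PE (by omega) (by omega) (fun z hz _ _ => ⟨(hEbox z hz).2.2.1, (hEbox z hz).2.2.2⟩)
        PS.symm (by rw [fy1]; omega) (by rw [fx1]; omega) (fun z hz _ _ => by
          obtain ⟨u, hu, rfl⟩ := physS z hz
          obtain ⟨-, -, -, -, -, -, -, -, g0, g1, -⟩ := frameIso_apply_formula u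
          rw [Tube.mem_box] at hu; rw [g0]; constructor <;> omega)
      exact ⟨z, hzS, hzE⟩
    · -- frame 5 (`-σ`): the spoke is the reflected vertical tube; `E` horizontal
      obtain ⟨hEh, h1, h2, h3, h4⟩ := hJ
      rw [hEh] at hE1
      obtain ⟨hxE, hyE⟩ : xE 0 = E.a ∧ yE 0 = E.a + E.w := hE1
      obtain ⟨-, -, -, -, -, -, -, -, -, -, fx0, fx1⟩ := frameIso_apply_formula x'
      obtain ⟨-, -, -, -, -, -, -, -, -, -, fy0, fy1⟩ := frameIso_apply_formula y'
      obtain ⟨z, hzE, hzS⟩ := exists_mem_of_cross (L := -(Sp.b + Sp.h)) (R := -Sp.b) (B := E.b) (T := E.b + E.h)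
        (by omega) (by omega) PE (by omega) (by omega) (fun z hz _ _ => ⟨(hEbox z hz).2.2.1, (hEbox z hz).2.2.2⟩)
        PS.symm (by rw [fy1]; omega) (by rw [fx1]; omega) (fun z hz _ _ => by
          obtain ⟨u, hu, rfl⟩ := physS z hz
          obtain ⟨-, -, -, -, -, -, -, -, -, -, g0, g1⟩ := frameIso_apply_formula u
          rw [Tube.mem_box] at hu; rw [g0]; constructor <;> omega)
      exact ⟨z, hzS, hzE⟩
  -- (4) assemble
  obtain ⟨z, hzS, hzE⟩ := meet
  have Q1 : PathIn triGraph ((frameIso i '' (Sp.box ∪ (triAnnSet n (2 * M) ∪ otipBox M (Fo.z 1) Fo.k)) ∪ E.box) ∩ χ)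
      (frameIso i Fo.a) (frameIso i x') := by
    refine hcatch.symm.mono ?_
    rintro v ⟨hv | ⟨u, hu, rfl⟩, hvχ⟩
    · obtain ⟨u, hu, rfl⟩ := physS v hv
      exact ⟨Or.inl ⟨u, Or.inl hu, rfl⟩, hvχ⟩
    · exact ⟨Or.inl ⟨u, Or.inr hu, rfl⟩, hvχ⟩
  have Q2 : PathIn triGraph ((frameIso i '' (Sp.box ∪ (triAnnSet n (2 * M) ∪ otipBox M (Fo.z 1) Fo.k)) ∪ E.box) ∩ χ) (frameIso i x') z := by
    refine (star _ PS.left_mem z hzS).mono fun v hv => ?_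
    obtain ⟨u, hu, rfl⟩ := physS v hv
    exact ⟨Or.inl ⟨u, Or.inl hu, rfl⟩, hSχ hv⟩
  have Q3 : PathIn triGraph ((frameIso i '' (Sp.box ∪ (triAnnSet n (2 * M) ∪ otipBox M (Fo.z 1) Fo.k)) ∪ E.box) ∩ χ) z xE :=
    (TE z hzE).symm.mono fun v hv => ⟨Or.inr (hSE hv).1, (hSE hv).2⟩
  exact (Q1.trans Q2).trans Q3

end Literature.Probability.Percolation
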